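import Mathlib.Data.Nat.Choose.Sum
import Mathlib.Data.Fintype.Pigeonhole
import Mathlib.Data.Fintype.Powerset
import Mathlib.Data.Finset.Prod
import Mathlib.Algebra.BigOperators.Ring.Finset
import Mathlib.Algebra.Order.BigOperators.Group.Finset
import Mathlib.Algebra.Group.Action.Defs
import Mathlib.Tactic.Ring
import Mathlib.Tactic.Linarith

/-!
# Strictness of Sahi's hierarchy at every order, I: the pair functional of splits (finite combinatorics)

Support file of the master-family programme (crux `NoHeavyLowerTail`, stmt-CriticalPhenomena-4575; cell `prim-masterthm`,
seat P4, unit `prim-masterthm-p4-g4`).  Pure finite combinatorics on `Fin (n+1)`; no measure, no poset.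

Context (see `SahiMasterFamilyStrictHierarchy*` and the seat's PROOF-STRICTNESS.md).  In the representative form of Sahi's
`E_{n+1}` (`SahiMasterFamilyRepresentativeForm`) on a law with light atoms, the second-order term is a sum over systems of
representatives taking exactly two values `a ≠ b`; rooting at slot `0`, such a system is an ordered pair of atoms together with a
SPLIT `B ⊔ Bᶜ` of the slots (`0 ∈ B ≠ univ`, slots in `B` represented by `a`, the others by `b`), admissible iff `B ⊆ R_a` and
`Bᶜ ⊆ R_b` (`R_a` = the slots whose event contains `a`), with weight `(|B|−1)!·(n−|B|)!` times masses.  This file studies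

* `pw n B = (|B| − 1)!·(n − |B|)!`, the admissible splits `adm R R'` / rooted `radm R R'`, and the PAIR FUNCTIONALS
  `pairSum R R' = Σ_{adm} pw`, `rpairSum R R' = Σ_{radm} pw` (`rpairSum R R' + rpairSum R' R = pairSum R R'`);
* `pairSum_eq_zero_of_common_miss` (a slot outside `R ∪ R'` kills every split), `pairSum_mono`,
  `pairSum_erase_erase : pairSum (univ.erase i) (univ.erase i') = n!` (`i ≠ i'`), hence `pairSum_le_factorial` whenever
  `R, R' ≠ univ`, and the crude `pairSum_le_pow_mul_factorial`;
* **the combinatorial heart** `sum_offDiag_rpairSum_le`: for `w` columns `R_j ≠ univ` on FEWER THAN `w` slots (`n + 1 < w`),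
  `2·Σ_{j ≠ j'} rpairSum (R j) (R j') ≤ (w² − w − 2)·n!` — every unordered pair of columns contributes at most `n!`, and by
  PIGEONHOLE two columns miss a common slot and contribute `0`; whereas for the `w` co-singleton columns on `w` slots
  (`sum_offDiag_rpairSum_erase`) the value is `(w² − w)·(w−1)!`.  This gap of exactly one unit of `n!` is what separates order `w`
  from the orders below it in `SahiMasterFamilyStrictHierarchy`.
HONEST FRAMING: elementary counting; [this work].
-/

namespace Summit.CriticalPhenomena.PercolationContinuityZ3.Theorems

namespace SahiPairFunctional

open Finset Nat

variable {n : ℕ}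

/-! ### Splits and their weights -/

/-- The weight of the split `B ⊔ Bᶜ` of `Fin (n+1)`: `(|B| − 1)!·(n − |B|)!`. [this work] -/
def pw (n : ℕ) (B : Finset (Fin (n + 1))) : ℕ := (#B - 1)! * (n - #B)!

/-- The weight is symmetric under complementation. [this work] -/
theorem pw_compl (B : Finset (Fin (n + 1))) : pw n (univ \ B) = pw n B := by
  have hB : #B ≤ n + 1 := by simpa using card_le_univ B
  rw [pw, pw, card_univ_sdiff, Fintype.card_fin, mul_comm]
  have h1 : n + 1 - #B - 1 = n - #B := by omega
  have h2 : n - (n + 1 - #B) = #B - 1 := by omega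
  rw [h1, h2]

/-- Every weight is at most `n!`. [this work] -/
theorem pw_le_factorial (B : Finset (Fin (n + 1))) : pw n B ≤ n ! := by
  have hB : #B ≤ n + 1 := by simpa using card_le_univ B
  unfold pw
  calc (#B - 1)! * (n - #B)! ≤ (#B - 1 + (n - #B))! :=
        Nat.le_of_dvd (factorial_pos _) (Nat.factorial_mul_factorial_dvd_factorial_add _ _)
    _ ≤ n ! := Nat.factorial_le (by omega)

/-- Admissible splits for the ordered pair of columns `(R, R')`: nonempty, proper, `B ⊆ R`, `Bᶜ ⊆ R'`. [this work] -/
def adm (R R' : Finset (Fin (n + 1))) : Finset (Finset (Fin (n + 1))) :=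
  univ.filter fun B => B.Nonempty ∧ B ≠ univ ∧ B ⊆ R ∧ univ \ B ⊆ R'

/-- Admissible splits ROOTED at slot `0` (`0 ∈ B`). [this work] -/
def radm (R R' : Finset (Fin (n + 1))) : Finset (Finset (Fin (n + 1))) :=
  univ.filter fun B => (0 : Fin (n + 1)) ∈ B ∧ B ≠ univ ∧ B ⊆ R ∧ univ \ B ⊆ R'

/-- Membership in `adm`. [this work] -/
theorem mem_adm {R R' B : Finset (Fin (n + 1))} :
    B ∈ adm R R' ↔ B.Nonempty ∧ B ≠ univ ∧ B ⊆ R ∧ univ \ B ⊆ R' := by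
  simp [adm]

/-- Membership in `radm`. [this work] -/
theorem mem_radm {R R' B : Finset (Fin (n + 1))} :
    B ∈ radm R R' ↔ (0 : Fin (n + 1)) ∈ B ∧ B ≠ univ ∧ B ⊆ R ∧ univ \ B ⊆ R' := by
  simp [radm]

/-- The pair functional `Σ_{B ∈ adm R R'} pw n B`. [this work] -/
def pairSum (R R' : Finset (Fin (n + 1))) : ℕ := ∑ B ∈ adm R R', pw n B

/-- The rooted pair functional `Σ_{B ∈ radm R R'} pw n B`. [this work] -/
def rpairSum (R R' : Finset (Fin (n + 1))) : ℕ := ∑ B ∈ radm R R', pw n B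

/-- Rooted splits are admissible splits. [this work] -/
theorem radm_subset_adm (R R' : Finset (Fin (n + 1))) : radm R R' ⊆ adm R R' := by
  intro B hB
  rw [mem_radm] at hB
  exact mem_adm.2 ⟨⟨0, hB.1⟩, hB.2⟩

/-- `rpairSum ≤ pairSum`. [this work] -/
theorem rpairSum_le_pairSum (R R' : Finset (Fin (n + 1))) : rpairSum R R' ≤ pairSum R R' :=
  sum_le_sum_of_subset (radm_subset_adm R R')

/-- **Un-rooting**: the admissible splits of `(R, R')` not containing `0` are the complements of the rooted splits of `(R', R)`,
so `rpairSum R R' + rpairSum R' R = pairSum R R'`. [this work] -/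
theorem rpairSum_add_rpairSum_swap (R R' : Finset (Fin (n + 1))) :
    rpairSum R R' + rpairSum R' R = pairSum R R' := by
  rw [pairSum, ← sum_filter_add_sum_filter_not (adm R R') (fun B => (0 : Fin (n + 1)) ∈ B)]
  congr 1
  · refine sum_congr ?_ fun _ _ => rfl
    ext B
    simp only [mem_radm, mem_filter, mem_adm]
    constructor
    · rintro ⟨h0, h⟩; exact ⟨⟨⟨0, h0⟩, h⟩, h0⟩
    · rintro ⟨⟨_, h⟩, h0⟩; exact ⟨h0, h⟩
  · -- complement bijection `radm R' R → {B ∈ adm R R' | 0 ∉ B}`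
    refine sum_nbij' (fun C => univ \ C) (fun B => univ \ B) ?_ ?_ ?_ ?_ ?_
    · intro C hC
      rw [mem_radm] at hC
      obtain ⟨h0, hne, hR', hR⟩ := hC
      rw [mem_filter, mem_adm, Finset.sdiff_sdiff_eq_self (subset_univ C)]
      refine ⟨⟨?_, ?_, hR, hR'⟩, ?_⟩
      · rw [sdiff_nonempty]
        exact fun h => hne (univ_subset_iff.mp h)
      · intro h
        have h0' : (0 : Fin (n + 1)) ∈ univ \ C := by rw [h]; exact mem_univ _
        exact (mem_sdiff.1 h0').2 h0
      · simp [h0]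
    · intro B hB
      rw [mem_filter, mem_adm] at hB
      obtain ⟨⟨hne, hnu, hR, hR'⟩, h0⟩ := hB
      rw [mem_radm, Finset.sdiff_sdiff_eq_self (subset_univ B)]
      refine ⟨by simp [h0], ?_, hR', hR⟩
      intro h
      obtain ⟨x, hx⟩ := hne
      have hx' : x ∈ univ \ B := by rw [h]; exact mem_univ x
      exact (mem_sdiff.1 hx').2 hx
    · intro C _; exact Finset.sdiff_sdiff_eq_self (subset_univ C)
    · intro B _; exact Finset.sdiff_sdiff_eq_self (subset_univ B)
    · intro C _; exact (pw_compl C).symm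

/-! ### Zero, monotonicity, the co-singleton value -/

/-- **A common missing slot kills every split**: if some slot lies outside `R ∪ R'` then `adm R R' = ∅`. [this work] -/
theorem adm_eq_empty_of_common_miss {R R' : Finset (Fin (n + 1))} {i : Fin (n + 1)} (hi : i ∉ R) (hi' : i ∉ R') :
    adm R R' = ∅ := by
  refine eq_empty_of_forall_notMem fun B hB => ?_
  rw [mem_adm] at hB
  obtain ⟨-, -, hR, hR'⟩ := hB
  by_cases hB : i ∈ B
  · exact hi (hR hB)
  · exact hi' (hR' (mem_sdiff.2 ⟨mem_univ _, hB⟩))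

/-- Hence `pairSum R R' = 0` when a slot is missed by both columns. [this work] -/
theorem pairSum_eq_zero_of_common_miss {R R' : Finset (Fin (n + 1))} {i : Fin (n + 1)} (hi : i ∉ R) (hi' : i ∉ R') :
    pairSum R R' = 0 := by
  rw [pairSum, adm_eq_empty_of_common_miss hi hi', sum_empty]

/-- And `rpairSum R R' = 0` likewise. [this work] -/
theorem rpairSum_eq_zero_of_common_miss {R R' : Finset (Fin (n + 1))} {i : Fin (n + 1)} (hi : i ∉ R) (hi' : i ∉ R') :
    rpairSum R R' = 0 :=
  Nat.eq_zero_of_le_zero ((rpairSum_le_pairSum R R').trans (pairSum_eq_zero_of_common_miss hi hi').le)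

/-- The pair functional is monotone in both columns. [this work] -/
theorem pairSum_mono {R R' S S' : Finset (Fin (n + 1))} (h : R ⊆ S) (h' : R' ⊆ S') : pairSum R R' ≤ pairSum S S' := by
  refine sum_le_sum_of_subset fun B hB => ?_
  rw [mem_adm] at hB ⊢
  exact ⟨hB.1, hB.2.1, hB.2.2.1.trans h, hB.2.2.2.trans h'⟩

/-- Admissible splits of two co-singleton columns: `i ∉ B ∋ i'`. [this work] -/
theorem mem_adm_erase_erase {i i' : Fin (n + 1)} {B : Finset (Fin (n + 1))} :
    B ∈ adm (univ.erase i) (univ.erase i') ↔ i ∉ B ∧ i' ∈ B := by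
  rw [mem_adm, subset_erase, subset_erase]
  simp only [subset_univ, true_and, mem_sdiff, mem_univ, not_not]
  constructor
  · rintro ⟨-, -, hi, hi'⟩; exact ⟨hi, hi'⟩
  · rintro ⟨hi, hi'⟩
    exact ⟨⟨i', hi'⟩, fun h => hi (h ▸ mem_univ i), hi, hi'⟩

/-- `Σ_{m ≤ N} C(N,m)·m!·(N−m)! = (N+1)·N!`. [folklore] -/
theorem sum_choose_mul_factorial_mul_factorial (N : ℕ) :
    ∑ m ∈ range (N + 1), N.choose m * (m ! * (N - m)!) = (N + 1) * N ! := by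
  calc ∑ m ∈ range (N + 1), N.choose m * (m ! * (N - m)!) = ∑ m ∈ range (N + 1), N ! :=
        sum_congr rfl fun m hm => by
          rw [← mul_assoc]
          exact choose_mul_factorial_mul_factorial (Nat.lt_succ_iff.mp (mem_range.mp hm))
    _ = (N + 1) * N ! := by rw [sum_const, card_range, smul_eq_mul]

/-- **The value on two distinct co-singleton columns**: `pairSum (univ.erase i) (univ.erase i') = n!`. [this work] -/
theorem pairSum_erase_erase {i i' : Fin (n + 1)} (hii' : i ≠ i') : pairSum (univ.erase i) (univ.erase i') = n ! := by
  -- `n ≥ 1`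
  obtain ⟨m, rfl⟩ : ∃ m, n = m + 1 := by
    rcases n with _ | m
    · exact absurd (Fin.ext (by have := i.isLt; have := i'.isLt; omega)) hii'
    · exact ⟨m, rfl⟩
  set S : Finset (Fin (m + 2)) := univ \ {i, i'} with hS
  have hcardS : #S = m := by
    rw [hS, card_univ_sdiff, Fintype.card_fin, card_pair hii']
    rfl
  have hiS : i ∉ S := by simp [hS]
  have hi'S : i' ∉ S := by simp [hS]
  rw [pairSum]
  calc ∑ B ∈ adm (univ.erase i) (univ.erase i'), pw (m + 1) B = ∑ C ∈ S.powerset, (#C)! * (m - #C)! := by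
        refine sum_nbij' (fun B => B.erase i') (fun C => insert i' C) ?_ ?_ ?_ ?_ ?_
        · intro B hB
          rw [mem_adm_erase_erase] at hB
          rw [mem_powerset, hS, subset_sdiff]
          refine ⟨subset_univ _, ?_⟩
          simp [disjoint_insert_right, hB.1]
        · intro C hC
          rw [mem_powerset] at hC
          rw [mem_adm_erase_erase]
          refine ⟨?_, mem_insert_self _ _⟩
          rw [mem_insert]
          rintro (h | h)
          · exact hii' h
          · exact hiS (hC h)
        · intro B hB
          rw [mem_adm_erase_erase] at hB
          exact insert_erase hB.2
        · intro C hC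
          rw [mem_powerset] at hC
          exact erase_insert fun h => hi'S (hC h)
        · intro B hB
          rw [mem_adm_erase_erase] at hB
          have hcard : #(B.erase i') = #B - 1 := card_erase_of_mem hB.2
          have hpos : 1 ≤ #B := card_pos.2 ⟨i', hB.2⟩
          have hle : #B ≤ m + 1 := by
            have := card_le_card (subset_univ B |>.trans (subset_univ _))
            have h2 : #B ≤ #(univ.erase i) := card_le_card (subset_erase.2 ⟨subset_univ _, hB.1⟩)
            rw [card_erase_of_mem (mem_univ _), card_univ, Fintype.card_fin] at h2
            omega
          rw [pw, hcard]
          congr 2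
          omega
    _ = ∑ j ∈ range (#S + 1), (#S).choose j • (j ! * (m - j)!) := sum_powerset_apply_card (fun c => c ! * (m - c)!)
    _ = (m + 1) * m ! := by
        rw [hcardS]
        simp only [smul_eq_mul]
        exact sum_choose_mul_factorial_mul_factorial m
    _ = (m + 1)! := (Nat.factorial_succ m).symm

/-- **Every unordered pair of proper columns contributes at most `n!`.** [this work] -/
theorem pairSum_le_factorial {R R' : Finset (Fin (n + 1))} (hR : R ≠ univ) (hR' : R' ≠ univ) : pairSum R R' ≤ n ! := by
  obtain ⟨i, -, hi⟩ := exists_of_ssubset (ssubset_univ_iff.2 hR)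
  obtain ⟨i', -, hi'⟩ := exists_of_ssubset (ssubset_univ_iff.2 hR')
  by_cases h : i = i'
  · subst h
    rw [pairSum_eq_zero_of_common_miss hi hi']
    exact Nat.zero_le _
  · calc pairSum R R' ≤ pairSum (univ.erase i) (univ.erase i') :=
          pairSum_mono (subset_erase.2 ⟨subset_univ _, hi⟩) (subset_erase.2 ⟨subset_univ _, hi'⟩)
      _ = n ! := pairSum_erase_erase h

/-- Crude bound: `pairSum R R' ≤ 2^{n+1}·n!`. [this work] -/
theorem pairSum_le_pow_mul_factorial (R R' : Finset (Fin (n + 1))) : pairSum R R' ≤ 2 ^ (n + 1) * n ! := by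
  calc pairSum R R' ≤ ∑ B ∈ (univ : Finset (Finset (Fin (n + 1)))), pw n B :=
        sum_le_sum_of_subset (filter_subset _ _)
    _ ≤ #(univ : Finset (Finset (Fin (n + 1)))) • n ! := sum_le_card_nsmul _ _ _ fun B _ => pw_le_factorial B
    _ = 2 ^ (n + 1) * n ! := by rw [card_univ, Fintype.card_finset, Fintype.card_fin, smul_eq_mul]

/-- Crude bound for the rooted functional. [this work] -/
theorem rpairSum_le_pow_mul_factorial (R R' : Finset (Fin (n + 1))) : rpairSum R R' ≤ 2 ^ (n + 1) * n ! :=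
  (rpairSum_le_pairSum R R').trans (pairSum_le_pow_mul_factorial R R')

/-! ### Sums over ordered pairs of columns -/

/-- Swapping the two columns does not change the sum of the rooted functional over all ordered pairs. [this work] -/
theorem sum_offDiag_rpairSum_swap {w : ℕ} (R : Fin w → Finset (Fin (n + 1))) :
    ∑ p ∈ (univ : Finset (Fin w)).offDiag, rpairSum (R p.2) (R p.1) =
      ∑ p ∈ (univ : Finset (Fin w)).offDiag, rpairSum (R p.1) (R p.2) := by
  refine sum_equiv (Equiv.prodComm (Fin w) (Fin w)) (fun p => ?_) (fun p _ => rfl)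
  simp only [mem_offDiag, mem_univ, true_and, Equiv.prodComm_apply, Prod.fst_swap, Prod.snd_swap]
  exact ne_comm

/-- Twice the rooted sum over ordered pairs is the un-rooted sum over ordered pairs. [this work] -/
theorem two_mul_sum_offDiag_rpairSum {w : ℕ} (R : Fin w → Finset (Fin (n + 1))) :
    2 * ∑ p ∈ (univ : Finset (Fin w)).offDiag, rpairSum (R p.1) (R p.2) =
      ∑ p ∈ (univ : Finset (Fin w)).offDiag, pairSum (R p.1) (R p.2) := by
  rw [two_mul]
  nth_rw 1 [← sum_offDiag_rpairSum_swap R]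
  rw [← sum_add_distrib]
  exact sum_congr rfl fun p _ => by rw [add_comm]; exact rpairSum_add_rpairSum_swap _ _

/-- **The combinatorial heart.**  `w` proper columns on fewer than `w` slots: twice the rooted pair functional summed over
ordered pairs of distinct columns is at most `(w² − w − 2)·n!` — one full unit of `n!` (one unordered pair) below the number
of ordered pairs, because by pigeonhole two columns miss a common slot. [this work] -/
theorem sum_offDiag_rpairSum_le {w : ℕ} (hw : n + 1 < w) (R : Fin w → Finset (Fin (n + 1)))
    (hR : ∀ j, R j ≠ univ) :
    2 * ∑ p ∈ (univ : Finset (Fin w)).offDiag, rpairSum (R p.1) (R p.2) ≤ (w * w - w - 2) * n ! := by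
  rw [two_mul_sum_offDiag_rpairSum]
  -- choose a missing slot in every column; two columns share it
  have hmiss : ∀ j, ∃ i, i ∉ R j := fun j => by
    obtain ⟨i, -, hi⟩ := exists_of_ssubset (ssubset_univ_iff.2 (hR j))
    exact ⟨i, hi⟩
  choose ι hι using hmiss
  obtain ⟨j₁, j₂, hne, heq⟩ := Fintype.exists_ne_map_eq_of_card_lt ι (by simpa using hw)
  set T : Finset (Fin w × Fin w) := {(j₁, j₂), (j₂, j₁)} with hT
  have hTsub : T ⊆ (univ : Finset (Fin w)).offDiag := by
    intro p hp
    rw [hT, mem_insert, mem_singleton] at hp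
    rcases hp with rfl | rfl <;> simp [mem_offDiag, hne, hne.symm]
  have hTcard : #T = 2 := by
    rw [hT, card_pair]
    intro h
    exact hne (Prod.ext_iff.1 h).1
  have hzero : ∑ p ∈ T, pairSum (R p.1) (R p.2) = 0 := by
    rw [hT, sum_pair (fun h => hne (Prod.ext_iff.1 h).1)]
    rw [pairSum_eq_zero_of_common_miss (hι j₁) (heq ▸ hι j₂),
      pairSum_eq_zero_of_common_miss (hι j₂) (heq.symm ▸ hι j₁)]
  have hcard : #((univ : Finset (Fin w)).offDiag \ T) = w * w - w - 2 := by
    rw [card_sdiff_of_subset hTsub, offDiag_card, card_univ, Fintype.card_fin, hTcard]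
  rw [← sum_sdiff hTsub, hzero, add_zero, ← hcard]
  calc ∑ p ∈ univ.offDiag \ T, pairSum (R p.1) (R p.2) ≤ #(univ.offDiag \ T) • n ! :=
        sum_le_card_nsmul _ _ _ fun p _ => pairSum_le_factorial (hR _) (hR _)
    _ = #(univ.offDiag \ T) * n ! := smul_eq_mul _ _

/-- **The violating family**: for the `w` co-singleton columns on `w = n+1` slots twice the rooted sum is `(w² − w)·n!`
(every ordered pair of distinct columns contributes `n!`). [this work] -/
theorem sum_offDiag_rpairSum_erase :
    2 * ∑ p ∈ (univ : Finset (Fin (n + 1))).offDiag, rpairSum (univ.erase p.1) (univ.erase p.2) =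
      ((n + 1) * (n + 1) - (n + 1)) * n ! := by
  rw [two_mul_sum_offDiag_rpairSum (fun j : Fin (n + 1) => univ.erase j)]
  rw [sum_congr rfl fun p hp => pairSum_erase_erase (mem_offDiag.1 hp).2.2, sum_const, smul_eq_mul, offDiag_card,
    card_univ, Fintype.card_fin]

end SahiPairFunctional

end Summit.CriticalPhenomena.PercolationContinuityZ3.Theorems
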